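import Mathlib
import Summits.PneNP.PneNP.Theses.AeaCutRectangles

/-!
# Crux-triage round 2, seat 1, gen 1 (TRIAGE-r2-1.md, three 15:20Z cards) — kernel checks
# (crux `FoolingMeasure` = X1, stmt-PneNP-19727, route AeaCutRectangles)

FRONTIER restricted-model rung (AEA cut rectangles vs NON-3-COL).  Nothing here bears on P vs NP, which is NOT proved.

* §0 (all three cards, objection X-1 "sign of C"): in `FoolingMeasure` the constant `C` is quantified AGAINST the measure
  (`∀ C : ℕ, ∃ᶠ n, ∃ μ, … ≤ 2^(−(n/2)·log₂ n − C·n)`), so the NEGATION lets the refuter CHOOSE `C`, and the body is ANTITONE in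
  `C`: a rectangle that beats the threshold at `C` beats it at every `C' ≥ C` (`x1Body_anti`, `threshold_antitone`).
  Hence the refuter's bit budget is `(n/2)·log₂ n + C·n` with `C` his, not `(n/2)·log₂ n − C·n` as the cards' "δ·2^{Cn}-heavy" /
  "affordable |P| ≤ (1 − 2C/log₂n)|B|" assume.
* §B (card `sparse-greenwell-lovasz`): `SparseGL` is mirrored VERBATIM from `Cruxes/FoolingMeasure/IdeasR2s2g9.lean` §B (Cruxes files
  are not importable on the farm).  A 5-vertex FORCED (site pair bireachable through arcs ⇒ every zero-winding colouring improper,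
  every projection colouring `ε·res + κ` improper) yet 3-COLOURABLE instance satisfies `SparseGL` with `L = 2` and violates it with
  `L = 1`: so `SparseGL … L` for `L ≥ 2` does NOT imply darkness of a forced instance; only `L = 0` does, and at `L = 0` the predicate
  (for instances whose every frame has a site) IS "no proper colouring".  This is a logical toy about the typed predicate, not a `μ_t` hybrid.
-/

set_option linter.dupNamespace false

namespace Summit.PneNP.PneNP.Cruxes.FoolingMeasure.TriageR2s1g1

open Finset Relation

/-! ## §0  The sign of `C` in X1 -/

/-- The body of `FoolingMeasure` at fixed `ε, C, n` (VERBATIM). -/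
def X1Body (ε : ℝ) (C n : ℕ) : Prop :=
  ∃ μ : Finset (Sym2 (Fin n)) → ℝ, (∀ S, 0 ≤ μ S) ∧ (∑ S, μ S = 1) ∧ (∀ S, μ S ≠ 0 → (∀ e ∈ S, ¬ e.IsDiag) ∧ ¬ (SimpleGraph.fromEdgeSet (S : Set (Sym2 (Fin n)))).Colorable 3) ∧ ∀ B : Finset (Fin n), (1 / 2 - ε) * (n : ℝ) ≤ B.card → (B.card : ℝ) ≤ (1 / 2 + ε) * n → ∀ 𝓐 𝓑 : Finset (Finset (Sym2 (Fin n))), (∀ α ∈ 𝓐, ∀ e ∈ α, ¬ e.IsDiag ∧ ∃ v ∈ e, v ∉ B) → (∀ β ∈ 𝓑, ∀ e ∈ β, ¬ e.IsDiag ∧ ∀ v ∈ e, v ∈ B) → (∀ α ∈ 𝓐, ∀ β ∈ 𝓑, ¬ (SimpleGraph.fromEdgeSet ((α ∪ β : Finset (Sym2 (Fin n))) : Set (Sym2 (Fin n)))).Colorable 3) → ∑ q ∈ 𝓐 ×ˢ 𝓑, μ (q.1 ∪ q.2) ≤ (2 : ℝ) ^ (-((n : ℝ) / 2 * Real.logb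 2 n) - (C : ℝ) * n)

theorem foolingMeasure_iff :
    Theses.AeaCutRectangles.FoolingMeasure ↔ ∃ ε : ℝ, 0 < ε ∧ ε ≤ 1 / 4 ∧ ∀ C : ℕ, ∃ᶠ n in Filter.atTop, X1Body ε C n :=
  Iff.rfl

/-- ¬X1 read off: for EVERY ε the refuter may pick ONE `C` and must then, for all large `n` and every measure, exhibit a cut and a valid
rectangle beating `2^(−(n/2)log₂n − C·n)`. -/
theorem not_foolingMeasure_iff :
    ¬ Theses.AeaCutRectangles.FoolingMeasure ↔
      ∀ ε : ℝ, 0 < ε → ε ≤ 1 / 4 → ∃ C : ℕ, ∀ᶠ n in Filter.atTop, ¬ X1Body ε C n := by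
  rw [foolingMeasure_iff]
  simp only [not_exists, not_and, not_forall, Filter.not_frequently]

/-- The threshold is antitone in `C`. -/
theorem threshold_antitone (n C C' : ℕ) (h : C ≤ C') :
    (2 : ℝ) ^ (-((n : ℝ) / 2 * Real.logb 2 n) - (C' : ℝ) * n) ≤ (2 : ℝ) ^ (-((n : ℝ) / 2 * Real.logb 2 n) - (C : ℝ) * n) := by
  apply Real.rpow_le_rpow_of_exponent_le (by norm_num)
  have : (C : ℝ) * n ≤ (C' : ℝ) * n := mul_le_mul_of_nonneg_right (by exact_mod_cast h) (by positivity)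
  linarith

/-- Larger `C` is HARDER for the measure / EASIER for the refuter: the X1 body is antitone in `C`. -/
theorem x1Body_anti {ε : ℝ} {C C' n : ℕ} (h : C ≤ C') : X1Body ε C' n → X1Body ε C n := by
  rintro ⟨μ, h0, h1, hsupp, hB⟩
  refine ⟨μ, h0, h1, hsupp, fun B hlo hhi 𝓐 𝓑 hA hBB hdark => ?_⟩
  exact le_trans (hB B hlo hhi 𝓐 𝓑 hA hBB hdark) (threshold_antitone n C C' h)

/-- Contrapositive, the form the refuter uses: a refutation of the body at `C` is a refutation at every `C' ≥ C`. -/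
theorem not_x1Body_mono {ε : ℝ} {C C' n : ℕ} (h : C ≤ C') : ¬ X1Body ε C n → ¬ X1Body ε C' n :=
  fun hC hC' => hC (x1Body_anti h hC')

/-! ## §B  `SparseGL` with `L ≥ 2` does not give darkness (card `sparse-greenwell-lovasz`) -/

/-- VERBATIM mirror of `IdeasR2s2g9.SparseGL`. -/
def SparseGL (t : ℕ) (V : Type*) [Fintype V] [DecidableEq V] (res : Fin t → V → ZMod 3)
    (E : V → V → Prop) (L : ℕ) : Prop :=
  ∀ c : V → ZMod 3, (∀ u v, E u v → c u ≠ c v) →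
    ∃ (k : Fin t) (ε : ZMod 3) (κ : ZMod 3), ε ≠ 0 ∧
      ∃ S : Finset V, S.card ≤ L ∧ ∀ v, v ∉ S → c v = ε * res k v + κ

/-- VERBATIM mirror of `IdeasR2s2g9.BiReachable`. -/
def BiReachable {V : Type*} (arc : V → V → Prop) (x y : V) : Prop :=
  ReflTransGen arc x y ∧ ReflTransGen arc y x

/-- VERBATIM mirror of `IdeasR2s2g9.potential_eq_of_biReachable`. -/
theorem potential_eq_of_biReachable {V : Type*} (arc : V → V → Prop) (D : V → ℕ)
    (hmono : ∀ u v, arc u v → D u ≤ D v) {x y : V} (h : BiReachable arc x y) : D x = D y := by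
  have key : ∀ a b, ReflTransGen arc a b → D a ≤ D b := by
    intro a b hab
    induction hab with
    | refl => exact le_rfl
    | tail _ hbc ih => exact le_trans ih (hmono _ _ hbc)
  exact le_antisymm (key _ _ h.1) (key _ _ h.2)

/-- Toy vertex set `Fin 5`: `a = 0, b = 1, c = 2, x = 3, y = 4`; one frame (`t = 1`) with residues `a ↦ 0, b ↦ 1, c ↦ 2, x ↦ 0, y ↦ 1`. -/
def toyRes : Fin 1 → Fin 5 → ZMod 3 := fun _ v => ![0, 1, 2, 0, 1] v

/-- Toy edge list: triangle `a b c` (arcs `a→b→c→a`), SITE `{x, a}` (equal residues), arcs `c→x`, `x→y`, `y→c`. -/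
def toyAdj : Fin 5 → Fin 5 → Bool := fun u v =>
  decide ((u, v) ∈ [((0 : Fin 5), (1 : Fin 5)), (1, 0), (1, 2), (2, 1), (2, 0), (0, 2), (3, 0), (0, 3), (2, 3), (3, 2), (3, 4), (4, 3),
    (4, 2), (2, 4)])

/-- The toy edge relation (symmetric, loopless). -/
def toyE : Fin 5 → Fin 5 → Prop := fun u v => toyAdj u v = true

instance : DecidableRel toyE := fun u v => inferInstanceAs (Decidable (toyAdj u v = true))

theorem toyE_symm : ∀ u v, toyE u v → toyE v u := by decide

theorem toyE_irrefl : ∀ u, ¬ toyE u u := by decide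

/-- The frame digraph of the toy: edges oriented by `res v = res u + 1`. -/
def toyArc : Fin 5 → Fin 5 → Prop := fun u v => toyE u v ∧ toyRes 0 v = toyRes 0 u + 1

instance : DecidableRel toyArc := fun u v => inferInstanceAs (Decidable (toyE u v ∧ toyRes 0 v = toyRes 0 u + 1))

/-- The toy is LIGHT: `(a,b,c,x,y) ↦ (0,1,2,1,0)` is a proper 3-colouring. -/
theorem toy_light : ∃ c : Fin 5 → ZMod 3, ∀ u v, toyE u v → c u ≠ c v :=
  ⟨fun v => ![0, 1, 2, 1, 0] v, by decide⟩

/-- `{x, a}` is a SITE of the (only) frame. -/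
theorem toy_site : toyE 3 0 ∧ toyRes 0 3 = toyRes 0 0 := by decide

/-- The site pair is BIREACHABLE in the frame digraph (`x → y → c → a` and `a → b → c → x`): the toy is FORCED. -/
theorem toy_biReachable : BiReachable toyArc 3 0 := by
  refine ⟨?_, ?_⟩
  · exact ((ReflTransGen.single (show toyArc 3 4 by decide)).tail (show toyArc 4 2 by decide)).tail (show toyArc 2 0 by decide)
  · exact ((ReflTransGen.single (show toyArc 0 1 by decide)).tail (show toyArc 1 2 by decide)).tail (show toyArc 2 3 by decide)

/-- Forcing, kernel form: EVERY zero-winding colouring `res + D` (`D` an arc-monotone ℕ-potential) is improper at the site. -/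
theorem toy_forced (D : Fin 5 → ℕ) (hmono : ∀ u v, toyArc u v → D u ≤ D v) :
    toyRes 0 3 + (D 3 : ZMod 3) = toyRes 0 0 + (D 0 : ZMod 3) := by
  rw [toy_site.2, potential_eq_of_biReachable toyArc D hmono toy_biReachable]

/-- Every PROJECTION colouring `ε·res + κ` is improper (it fails at the site). -/
theorem toy_projections_improper :
    ∀ (k : Fin 1) (ε κ : ZMod 3), ¬ (∀ u v, toyE u v → ε * toyRes k u + κ ≠ ε * toyRes k v + κ) := by
  decide

/-- … yet `SparseGL` HOLDS with `L = 2` (every proper colouring is a projection colouring off the two vertices `x, y`). -/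
theorem toy_sparseGL_two : SparseGL 1 (Fin 5) toyRes toyE 2 := by
  intro c hc
  refine ⟨0, c 1 - c 0, c 0, ?_, {3, 4}, by decide, ?_⟩
  · intro h
    exact hc 0 1 (by decide) (by linear_combination (exp := 1) -h)
  · have h01 : c 0 ≠ c 1 := hc 0 1 (by decide)
    have h12 : c 1 ≠ c 2 := hc 1 2 (by decide)
    have h20 : c 2 ≠ c 0 := hc 2 0 (by decide)
    intro v hv
    fin_cases v
    · simp [toyRes]
    · simp [toyRes]
    · simp only [toyRes]
      -- c 2 is the third colour: c 2 = 2 (c 1 - c 0) + c 0 = 2 c1 - c0 = -(c0 + c1) in ZMod 3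
      have key : ∀ p q r : ZMod 3, p ≠ q → q ≠ r → r ≠ p → r = (q - p) * 2 + p := by decide
      simpa [Matrix.cons_val] using key (c 0) (c 1) (c 2) h01 h12 h20
    · simp at hv
    · simp at hv

/-- … and FAILS with `L = 1`. -/
theorem toy_not_sparseGL_one : ¬ SparseGL 1 (Fin 5) toyRes toyE 1 := by
  intro h
  obtain ⟨k, ε, κ, hε, S, hS, hcol⟩ := h (fun v => ![0, 1, 2, 1, 0] v) (by decide)
  -- the proper colouring (0,1,2,1,0) differs from ε·res+κ at ≥ 2 vertices for every (ε, κ)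
  have two : ∀ ε κ : ZMod 3, ε ≠ 0 →
      2 ≤ (Finset.univ.filter fun v : Fin 5 => (![0, 1, 2, 1, 0] v : ZMod 3) ≠ ε * toyRes k v + κ).card := by
    have hk : k = 0 := Subsingleton.elim _ _
    subst hk
    decide
  have hsub : (Finset.univ.filter fun v : Fin 5 => (![0, 1, 2, 1, 0] v : ZMod 3) ≠ ε * toyRes k v + κ) ⊆ S := by
    intro v hv
    by_contra hvS
    exact (Finset.mem_filter.1 hv).2 (hcol v hvS)
  have := le_trans (two ε κ hε) (le_trans (Finset.card_le_card hsub) hS)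
  omega

end Summit.PneNP.PneNP.Cruxes.FoolingMeasure.TriageR2s1g1
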